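import Summits.MatrixMultiplication.OmegaCensus.SmallFormats.MatMul22nRankGF7Slack5Search
import HarnessLib

/-!
# ω-census family (a): replay of the slack-5 search certificate, CHECK B part 7 of 8 (classes `486 ≤ c < 532`)

Cell `pub-omega` (unit `pub-omega-tensor-g16`), topic `Summits/MatrixMultiplication/OmegaCensus` (sub-folder `SmallFormats`).
Framing (verbatim): lottery ticket; floor = certified bounds/negative ranges. HONEST FRAMING: machine-generated kernel replay
(`pub-omega-tensor-g16/code/gen5_runs.py`): `search5 c = true` for the classes `486 ≤ c < 532` (4532 search nodes in 4 `decide`s).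
Meaning (`search5_sound`, `MatMul22nRankGF7Slack5SearchSound`): no LP-tight point of slack 5 has one of these representatives as torus-0 column.
Nothing here is progress on `ω`.
-/

namespace Summit.MatrixMultiplication.OmegaCensus.SmallFormats

set_option Elab.async false

set_option maxRecDepth 100000 in
set_option maxHeartbeats 400000000 in
/-- Classes `486 ≤ c < 496` (524 nodes). -/
theorem search5_ok_486_496 : ∀ c : Fin 656, 486 ≤ c.val → c.val < 496 → search5 c.val = true := by decide +kernel

set_option maxRecDepth 100000 in
set_option maxHeartbeats 400000000 in
/-- Classes `496 ≤ c < 498` (1076 nodes). -/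
theorem search5_ok_496_498 : ∀ c : Fin 656, 496 ≤ c.val → c.val < 498 → search5 c.val = true := by decide +kernel

set_option maxRecDepth 100000 in
set_option maxHeartbeats 400000000 in
/-- Classes `498 ≤ c < 499` (1439 nodes). -/
theorem search5_ok_498_499 : ∀ c : Fin 656, 498 ≤ c.val → c.val < 499 → search5 c.val = true := by decide +kernel

set_option maxRecDepth 100000 in
set_option maxHeartbeats 400000000 in
/-- Classes `499 ≤ c < 532` (1493 nodes). -/
theorem search5_ok_499_532 : ∀ c : Fin 656, 499 ≤ c.val → c.val < 532 → search5 c.val = true := by decide +kernel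

/-- CHECK B for the classes `486 ≤ c < 532`. -/
theorem search5_run_7 : ∀ c : Fin 656, 486 ≤ c.val → c.val < 532 → search5 c.val = true := by
  intro c hlo hhi
  by_cases h496 : c.val < 496
  · exact search5_ok_486_496 c (by omega) h496
  by_cases h498 : c.val < 498
  · exact search5_ok_496_498 c (by omega) h498
  by_cases h499 : c.val < 499
  · exact search5_ok_498_499 c (by omega) h499
  exact search5_ok_499_532 c (by omega) hhi

end Summit.MatrixMultiplication.OmegaCensus.SmallFormats
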